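import Summits.BirchSwinnertonDyer.BirchSwinnertonDyer.Theorems.SmallImageMuTransferMuTransferX9LocalSplitNaturality
import Summits.BirchSwinnertonDyer.BirchSwinnertonDyer.Theorems.SmallImageMuTransferMuTransferX9LocalTransverseValue
import Summits.BirchSwinnertonDyer.BirchSwinnertonDyer.Theorems.SmallImageMuTransferMuTransferX9PairingUniqueness
import HarnessLib

/-!
# K6 crux `MuTransferX9` (stmt-BirchSwinnertonDyer-19276), CORE-PLAN S4.3 on the genuine objects, file 2/5:
# shift algebra on `𝒯_J` and the VALUE PARAMETRISATION of transverse classes of the local twist at an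
# `E`-split prime (`H¹_tr(K_q, 𝒯_J) ≅ 𝒯_J[T^(p^m)] = T^(J ∸ p^m) 𝒯_J`, value at a tame generator `t₀`)

Cell `bsd-smallim`, seat `bsd-smallim-koly` gen 8 (route `SmallImageMuTransfer`, rung K6, leaf
`Rank1Residual.BSDpOnClassX9`). HONEST FRAMING: TOOL theorems; no definition, no named fact, no `sorry`;
nothing is asserted about any curve and nothing is booked. Serves the registered stub `stub_stepsTwoFourX9`
of crux 19276 (skeleton v5 bbfcbeb8eb041500; the q-TERM of MU-TRANSFER-PROOF §5 STEP 4 = Lemma 1 (iii))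
and credits nothing toward its closure (`--supports … --as helper`). PARTITION (D-0054): X9 (A4) ×
p ∈ {5, 7} · X10b∧¬Surj (A5) × p = 3 (everything is stated for an odd prime / any number field) — helper;
closes NONE.

## Content
* shift algebra on `Fin J → M`: `shiftEnd_pow_apply_eq_zero_iff_mem_range` (`ker S^d = im S^(J∸d)`),
  `shiftEnd_pow_shiftEnd_pow_apply`, `shiftEnd_pow_comp_apply` (coordinatewise maps commute with `S`),
  `shiftEnd_pow_single_zero'`, `convCoeff_shiftEnd_pow_left_eq'` (`C_k(S^a x, y) = C_(k−a)(x, y)`),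
  `sum_range_mul_shift_reindex` (re-indexing `Σ u_j c_(k−j)` when `u_j = 0` below `s`).
* at an `E`-split Frobenius `Fr` of depth `m` (`m + 1 ≤ J`) of the local twist `𝒯_J|_q = κ.twistModP ρ J`
  restricted to `Γ_(K_q)` (`q ∤ p`, `ρ` unramified at `q`, `p ∣ N(q) − 1`, `χ̄_ℓ` onto on inertia):
  `toLocal_twistModP_eq_one_of_mem_absInertia`, `isUnramifiedAt_twistModP`,
  `cocycle_apply_mem_range_shiftEnd_pow` (EVERY cocycle's value at `t₀ ∈ I` lies in `T^(J∸p^m)𝒯_J`),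
  **`exists_transverse_cocycle_apply_eq`** (for every `t` a cocycle with TRANSVERSE class and value
  `T^(J∸p^m) t` at `t₀`: koly g7's `H¹_tr ≃+ 𝒯_J^Γ` with the value exposed),
  **`oneCocycleClass_eq_of_transverse_of_apply_eq`** (transverse classes are determined by the value at `t₀`).

References: K. Rubin, PCMI 18 (2011) Prop. 1.9.5 [Rubin2011]; B. Mazur, K. Rubin, Mem. AMS 799 (2004)
Lemma 1.2.1 [MazurRubin2004]; L. Washington, *Introduction to Cyclotomic Fields* §13.2 [Washington1997].
-/

set_option linter.dupNamespace false
set_option autoImplicit false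

noncomputable section

open scoped Classical ContRepresentation

universe u

namespace Summit.BirchSwinnertonDyer.BirchSwinnertonDyer.Rank1Residual.LocalSplitPrime

open CategoryTheory ContinuousCohomology Function Field ValuativeRel NumberField IsDedekindDomain Finset
open Literature.NumberTheory.GaloisRepresentations
open Literature.NumberTheory.GaloisRepresentations.IsNonarchimedeanLocalField
open _root_.TopRep
open Literature.NumberTheory.GaloisCohomology
open Literature.NumberTheory.EllipticCurves
open Summit.BirchSwinnertonDyer.Rank1Residual.GaloisImage
open Summit.BirchSwinnertonDyer.Rank1Residual (X11b.LocBridge.mem_unramifiedSubgroup_one_iff_forall_eq_zero)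

/-! ## §3 The local twists at an `E`-split prime: transverse / unramified cocycles by their values -/

section ShiftAlgebra

variable {M : Type*} [AddCommGroup M] {J : ℕ}

/-- `ker S^d = im S^{J ∸ d}` on `Fin J → M` (`𝒯_J[T^d] = T^{J−d}𝒯_J`; for `d ≥ J` both are everything).
[cite: Washington1997, §13.1–§13.2] -/
theorem shiftEnd_pow_apply_eq_zero_iff_mem_range (d : ℕ) (x : Fin J → M) :
    (shiftEnd M J ^ d) x = 0 ↔ x ∈ LinearMap.range (shiftEnd M J ^ (J - d)) := by
  rw [shiftEnd_pow_apply_eq_zero_iff, mem_range_shiftEnd_pow_iff]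
  constructor
  · intro h i hi
    exact h i (by omega)
  · intro h j hj
    exact h j (by omega)

/-- `S^a (S^b x) = S^{a+b} x`. [cite: Washington1997, §13.1–§13.2] -/
theorem shiftEnd_pow_shiftEnd_pow_apply (a b : ℕ) (x : Fin J → M) :
    (shiftEnd M J ^ a) ((shiftEnd M J ^ b) x) = (shiftEnd M J ^ (a + b)) x := by
  rw [← Module.End.mul_apply, ← pow_add]

/-- `S^a (S x) = S^{a+1} x`. [cite: Washington1997, §13.1–§13.2] -/
theorem shiftEnd_pow_shiftEnd_apply (a : ℕ) (x : Fin J → M) :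
    (shiftEnd M J ^ a) (shiftEnd M J x) = (shiftEnd M J ^ (a + 1)) x := by
  rw [pow_succ, Module.End.mul_apply]

/-- `S (S^a x) = S^{a+1} x`. [cite: Washington1997, §13.1–§13.2] -/
theorem shiftEnd_shiftEnd_pow_apply (a : ℕ) (x : Fin J → M) :
    shiftEnd M J ((shiftEnd M J ^ a) x) = (shiftEnd M J ^ (a + 1)) x := by
  rw [pow_succ', Module.End.mul_apply]

/-- `S^a x = 0` once `J ≤ a`. [cite: Washington1997, §13.1–§13.2] -/
theorem shiftEnd_pow_apply_eq_zero_of_le {a : ℕ} (ha : J ≤ a) (x : Fin J → M) :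
    (shiftEnd M J ^ a) x = 0 := by
  rw [shiftEnd_pow_eq_zero ha, LinearMap.zero_apply]

/-- A coordinatewise additive map commutes with the powers of the shift. [cite: Washington1997, §13.1–§13.2] -/
theorem shiftEnd_pow_comp_apply {N : Type*} [AddCommGroup N] (f : M →+ N) (a : ℕ) (x : Fin J → M) :
    (shiftEnd N J ^ a) (fun i => f (x i)) = fun i => f ((shiftEnd M J ^ a) x i) := by
  funext i
  rw [shiftEnd_pow_apply, shiftEnd_pow_apply]
  split_ifs with h
  · rw [map_zero]
  · rfl

/-- `S^a (δ_0 m) = δ_a m` (`a < J`), in the `Fin`-free form used below. [cite: Washington1997, §13.1–§13.2] -/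
theorem shiftEnd_pow_single_zero' {a : ℕ} (ha : a < J) (m : M) :
    (shiftEnd M J ^ a) (Pi.single (⟨0, by omega⟩ : Fin J) m) = Pi.single (⟨a, ha⟩ : Fin J) m :=
  shiftEnd_pow_single_zero ⟨a, ha⟩ m

/-- **Re-indexing a weighted convolution by a shift of the weight.**  If `u_j = 0` for `j < s` and
`d_i = c_{i−s}` for `s ≤ i ≤ k`, `d_i = 0` for `i < s`, then
`Σ_{j ≤ k} u_j c_{k−j} = Σ_{j ≤ k} u_{s+j} d_{k−j}` — used to pass from the parametrisation `t` of a
transverse class to its VALUE `T^s t`. [folklore] -/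
theorem sum_range_mul_shift_reindex {R : Type*} [CommRing R] (u c d : ℕ → R) (s k : ℕ)
    (hu : ∀ j < s, u j = 0) (hd : ∀ i ≤ k, d i = if s ≤ i then c (i - s) else 0) :
    ∑ j ∈ Finset.range (k + 1), u j * c (k - j) = ∑ j ∈ Finset.range (k + 1), u (s + j) * d (k - j) := by
  by_cases hsk : s ≤ k
  · obtain ⟨r, rfl⟩ := Nat.exists_eq_add_of_le hsk
    have hL : ∑ j ∈ Finset.range (s + r + 1), u j * c (s + r - j) =
        ∑ x ∈ Finset.range (r + 1), u (s + x) * c (r - x) := by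
      rw [show s + r + 1 = s + (r + 1) by omega,
        Finset.sum_range_add (fun j => u j * c (s + r - j)) s (r + 1)]
      have h0 : ∑ x ∈ Finset.range s, u x * c (s + r - x) = 0 :=
        Finset.sum_eq_zero fun j hj => by rw [Finset.mem_range] at hj; rw [hu j hj, zero_mul]
      rw [h0, zero_add]
      refine Finset.sum_congr rfl fun x _ => ?_
      rw [show s + r - (s + x) = r - x by omega]
    have hR : ∑ j ∈ Finset.range (s + r + 1), u (s + j) * d (s + r - j) =
        ∑ x ∈ Finset.range (r + 1), u (s + x) * c (r - x) := by
      rw [show s + r + 1 = (r + 1) + s by omega,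
        Finset.sum_range_add (fun j => u (s + j) * d (s + r - j)) (r + 1) s]
      have h0 : ∑ x ∈ Finset.range s, u (s + (r + 1 + x)) * d (s + r - (r + 1 + x)) = 0 :=
        Finset.sum_eq_zero fun j hj => by
          rw [Finset.mem_range] at hj
          rw [hd _ (by omega), if_neg (by omega), mul_zero]
      rw [h0, add_zero]
      refine Finset.sum_congr rfl fun x hx => ?_
      rw [Finset.mem_range] at hx
      rw [hd _ (by omega), if_pos (by omega), show s + r - x - s = r - x by omega]
    rw [hL, hR]
  · have hL : ∑ j ∈ Finset.range (k + 1), u j * c (k - j) = 0 :=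
      Finset.sum_eq_zero fun j hj => by rw [Finset.mem_range] at hj; rw [hu j (by omega), zero_mul]
    have hR : ∑ j ∈ Finset.range (k + 1), u (s + j) * d (k - j) = 0 :=
      Finset.sum_eq_zero fun j hj => by
        rw [Finset.mem_range] at hj; rw [hd _ (by omega), if_neg (by omega), mul_zero]
    rw [hL, hR]

/-- `C_k(S^a x, y) = C_{k−a}(x, y)` if `a ≤ k`, else `0` (`k < J`): the convolution family is
shift-compatible (`family_shiftEnd_pow_left` for `convCoeffHom`; k6-c2's `convCoeff_shiftEnd_pow_left_eq`).
[cite: MazurRubin2004, §1.3 and §5.3] -/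
theorem convCoeff_shiftEnd_pow_left_eq' {M' P : Type*} [AddCommGroup M'] [AddCommGroup P]
    (e : M →+ M' →+ P) (a : ℕ) {k : ℕ} (hk : k < J) (x : Fin J → M) (y : Fin J → M') :
    convCoeff e J k ((shiftEnd M J ^ a) x) y = if a ≤ k then convCoeff e J (k - a) x y else 0 := by
  have h := family_shiftEnd_pow_left (convCoeffHom e J)
    (fun x y => by rw [convCoeffHom_apply]; exact convCoeff_zero_shiftEnd_left e x y)
    (fun k x y hk => by rw [convCoeffHom_apply, convCoeffHom_apply]; exact convCoeff_succ_shiftEnd_left e hk x y)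
    a hk x y
  simpa only [convCoeffHom_apply] using h

end ShiftAlgebra

section SplitValues

variable {K : Type u} [Field K] [NumberField K] {p : ℕ} [Fact p.Prime]
  {M : Type u} [AddCommGroup M] [TopologicalSpace M] [DiscreteTopology M] [Finite M]
  (ρ : DiscreteGaloisModule K M) (hM : ∀ x : M, p • x = 0) (κ : ZpExtension K p) (J : ℕ)
  (q : HeightOneSpectrum (𝓞 K)) [Fact (Ideal.absNorm q.asIdeal).Prime]
  [NeZero ((Ideal.absNorm q.asIdeal : ℕ) : q.adicCompletion K)]

omit [Finite M] [Fact (Ideal.absNorm q.asIdeal).Prime] [NeZero ((Ideal.absNorm q.asIdeal : ℕ) : q.adicCompletion K)] in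
/-- The local twist `𝒯_J|_q` is unramified as a representation of `Γ_{K_q}` (`q ∤ p`, `ρ` unramified):
packaging of file 2's `toLocal_twistModP_apply_of_mem_absInertia` in the `= 1` form.
[cite: Washington1997, Prop. 13.2] -/
theorem toLocal_twistModP_eq_one_of_mem_absInertia (hunr : GaloisRep.IsUnramifiedAt q ρ)
    (hqp : (p : 𝓞 K) ∉ q.asIdeal) {t : absoluteGaloisGroup (q.adicCompletion K)}
    (ht : t ∈ absInertia (q.adicCompletion K)) :
    GaloisRep.toLocal q (κ.twistModP ρ hM J) t = 1 :=
  LinearMap.ext fun x => toLocal_twistModP_apply_of_mem_absInertia ρ hM κ J q hunr hqp ht x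

omit [Finite M] [Fact (Ideal.absNorm q.asIdeal).Prime] [NeZero ((Ideal.absNorm q.asIdeal : ℕ) : q.adicCompletion K)] in
/-- `𝒯_J` is unramified at `q` as a `GaloisRep` (for the Tate-dual unramifiedness
`TransverseCup.toLocal_tateDual_apply_of_mem_absInertia`). [cite: Washington1997, Prop. 13.2] -/
theorem isUnramifiedAt_twistModP (hunr : GaloisRep.IsUnramifiedAt q ρ) (hqp : (p : 𝓞 K) ∉ q.asIdeal) :
    GaloisRep.IsUnramifiedAt q (κ.twistModP ρ hM J) :=
  (GaloisRep.isUnramifiedAt_iff_toLocal_holds q _).2 fun _ ht =>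
    toLocal_twistModP_eq_one_of_mem_absInertia ρ hM κ J q hunr hqp ht

/-- **Values of transverse cocycles** (file 4 + file 3): at an `E`-split Frobenius `Fr` of depth `m`,
the value at an inertia element `t₀` of ANY cocycle of `𝒯_J|_q` is fixed by `Γ_{K_q}`, hence lies in
`𝒯_J[T^{p^m}] = T^{J ∸ p^m}𝒯_J`. [cite: Rubin2011, Prop. 1.9.5 (1) (p. 16)] -/
theorem cocycle_apply_mem_range_shiftEnd_pow (hunr : GaloisRep.IsUnramifiedAt q ρ)
    (hqp : (p : 𝓞 K) ∉ q.asIdeal) (hpl : p ∣ Ideal.absNorm q.asIdeal - 1)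
    (hχI : ∀ u : (ZMod (Ideal.absNorm q.asIdeal))ˣ, ∃ t ∈ absInertia (q.adicCompletion K),
      modPCyclotomicCharacterZMod (q.adicCompletion K) (Ideal.absNorm q.asIdeal) t = u)
    {Fr : absoluteGaloisGroup (q.adicCompletion K)}
    (hsplit : ρ (absGaloisRestrict K (q.adicCompletion K) Fr) = 1) {m : ℕ} (hm : m + 1 ≤ J)
    (hFrm : absGaloisRestrict K (q.adicCompletion K) Fr ∈ κ.layerSubgroup m)
    (hFrm' : absGaloisRestrict K (q.adicCompletion K) Fr ∉ κ.layerSubgroup (m + 1))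
    (φ : contOneCocycles (GaloisRep.toLocal q (κ.twistModP ρ hM J)).toTopRep)
    {t₀ : absoluteGaloisGroup (q.adicCompletion K)} (ht₀ : t₀ ∈ absInertia (q.adicCompletion K)) :
    ∃ t : Fin J → M, φ.1 t₀ = (shiftEnd M J ^ (J - p ^ m)) t := by
  have hI : ∀ t ∈ absInertia (q.adicCompletion K), ∀ x : Fin J → M,
      GaloisRep.toLocal q (κ.twistModP ρ hM J) t x = x :=
    fun _ ht x => toLocal_twistModP_apply_of_mem_absInertia ρ hM κ J q hunr hqp ht x
  have hfix : GaloisRep.toLocal q (κ.twistModP ρ hM J) Fr (φ.1 t₀) = φ.1 t₀ :=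
    apply_cocycle_apply_eq_self_of_mem_absInertia _ (Ideal.absNorm q.asIdeal)
      (ringChar_residueField_adicCompletion_eq q) hI (sub_one_smul_eq_zero_of_dvd hM hpl) hχI φ ht₀ Fr
  have hker : (shiftEnd M J ^ (p ^ m)) (φ.1 t₀) = 0 :=
    (toLocal_twistModP_apply_eq_self_iff_of_split ρ hM κ J q hsplit hm hFrm hFrm' _).1 hfix
  obtain ⟨t, ht⟩ := (shiftEnd_pow_apply_eq_zero_iff_mem_range _ _).1 hker
  exact ⟨t, ht.symm⟩

/-- **A transverse class with prescribed value** (file 4's `H¹_tr ≅ 𝒯_J^{Γ}` at a tame generator `t₀`,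
surjectivity, with the value exposed): for every `t` there is a cocycle `φ` whose class is
`K_q(μ_ℓ)`-transverse and whose value at `t₀` is `T^{J ∸ p^m} t` (an arbitrary element of
`𝒯_J[T^{p^m}] = (𝒯_J|_q)^{Γ_{K_q}}`). [cite: Rubin2011, Prop. 1.9.5 (1) (p. 16)] -/
theorem exists_transverse_cocycle_apply_eq (hunr : GaloisRep.IsUnramifiedAt q ρ)
    (hqp : (p : 𝓞 K) ∉ q.asIdeal) (hpl : p ∣ Ideal.absNorm q.asIdeal - 1)
    (hχI : ∀ u : (ZMod (Ideal.absNorm q.asIdeal))ˣ, ∃ t ∈ absInertia (q.adicCompletion K),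
      modPCyclotomicCharacterZMod (q.adicCompletion K) (Ideal.absNorm q.asIdeal) t = u)
    {Fr : absoluteGaloisGroup (q.adicCompletion K)} (hFr : IsAbsArithFrob Fr)
    (hsplit : ρ (absGaloisRestrict K (q.adicCompletion K) Fr) = 1) {m : ℕ} (hm : m + 1 ≤ J)
    (hFrm : absGaloisRestrict K (q.adicCompletion K) Fr ∈ κ.layerSubgroup m)
    (hFrm' : absGaloisRestrict K (q.adicCompletion K) Fr ∉ κ.layerSubgroup (m + 1))
    {t₀ : absoluteGaloisGroup (q.adicCompletion K)} (ht₀ : t₀ ∈ absInertia (q.adicCompletion K))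
    (hgen : ∀ u : (ZMod (Ideal.absNorm q.asIdeal))ˣ,
      u ∈ Subgroup.zpowers (modPCyclotomicCharacterZMod (q.adicCompletion K) (Ideal.absNorm q.asIdeal) t₀))
    (t : Fin J → M) :
    ∃ φ : contOneCocycles (GaloisRep.toLocal q (κ.twistModP ρ hM J)).toTopRep,
      oneCocycleClass _ φ ∈ DiscreteGaloisModule.transverseSubgroup (GaloisRep.toLocal q (κ.twistModP ρ hM J))
        (CyclotomicField (Ideal.absNorm q.asIdeal) (q.adicCompletion K)) ∧
      φ.1 t₀ = (shiftEnd M J ^ (J - p ^ m)) t := by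
  have hI : ∀ t ∈ absInertia (q.adicCompletion K), ∀ x : Fin J → M,
      GaloisRep.toLocal q (κ.twistModP ρ hM J) t x = x :=
    fun _ ht x => toLocal_twistModP_apply_of_mem_absInertia ρ hM κ J q hunr hqp ht x
  obtain ⟨e, he⟩ := exists_transverseSubgroup_addEquiv_invariants
    (GaloisRep.toLocal q (κ.twistModP ρ hM J)) (Ideal.absNorm q.asIdeal)
    (ringChar_residueField_adicCompletion_eq q) hI (sub_one_smul_eq_zero_of_dvd hM hpl) hχI ht₀ hgen
  -- the prescribed value is `Γ_{K_q}`-invariant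
  have hzero : (shiftEnd M J ^ (p ^ m)) ((shiftEnd M J ^ (J - p ^ m)) t) = 0 := by
    rw [shiftEnd_pow_shiftEnd_pow_apply]
    exact shiftEnd_pow_apply_eq_zero_of_le (by omega) t
  have hv : (shiftEnd M J ^ (J - p ^ m)) t ∈
      (GaloisRep.toLocal q (κ.twistModP ρ hM J)).toTopRep.ρ.invariants :=
    fun g => (forall_toLocal_twistModP_apply_eq_self_iff_of_split ρ hM κ J q hunr hqp
      (IsAbsArithFrob.isFrobPow_holds hFr) hsplit hm hFrm hFrm' _).2 hzero g
  set c := e.symm ⟨_, hv⟩ with hc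
  obtain ⟨φ, hφ⟩ := oneCocycleClass_surjective _ c.1
  have hφtr : oneCocycleClass _ φ ∈ DiscreteGaloisModule.transverseSubgroup
      (GaloisRep.toLocal q (κ.twistModP ρ hM J))
      (CyclotomicField (Ideal.absNorm q.asIdeal) (q.adicCompletion K)) := by
    rw [hφ]; exact c.2
  refine ⟨φ, hφtr, ?_⟩
  have h1 : (⟨oneCocycleClass _ φ, hφtr⟩ : DiscreteGaloisModule.transverseSubgroup
      (GaloisRep.toLocal q (κ.twistModP ρ hM J))
      (CyclotomicField (Ideal.absNorm q.asIdeal) (q.adicCompletion K))) = c := Subtype.ext hφ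
  rw [← he φ hφtr, h1, hc, AddEquiv.apply_symm_apply]

/-- **Transverse classes are determined by their value at `t₀`** (file 4's injectivity, as an
equation between two cocycles). [cite: Rubin2011, Prop. 1.9.5 (1) (p. 16)] -/
theorem oneCocycleClass_eq_of_transverse_of_apply_eq (hunr : GaloisRep.IsUnramifiedAt q ρ)
    (hqp : (p : 𝓞 K) ∉ q.asIdeal) (hpl : p ∣ Ideal.absNorm q.asIdeal - 1)
    (hχI : ∀ u : (ZMod (Ideal.absNorm q.asIdeal))ˣ, ∃ t ∈ absInertia (q.adicCompletion K),
      modPCyclotomicCharacterZMod (q.adicCompletion K) (Ideal.absNorm q.asIdeal) t = u)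
    {t₀ : absoluteGaloisGroup (q.adicCompletion K)} (ht₀ : t₀ ∈ absInertia (q.adicCompletion K))
    (hgen : ∀ u : (ZMod (Ideal.absNorm q.asIdeal))ˣ,
      u ∈ Subgroup.zpowers (modPCyclotomicCharacterZMod (q.adicCompletion K) (Ideal.absNorm q.asIdeal) t₀))
    (φ₁ φ₂ : contOneCocycles (GaloisRep.toLocal q (κ.twistModP ρ hM J)).toTopRep)
    (h₁ : oneCocycleClass _ φ₁ ∈ DiscreteGaloisModule.transverseSubgroup (GaloisRep.toLocal q (κ.twistModP ρ hM J))
        (CyclotomicField (Ideal.absNorm q.asIdeal) (q.adicCompletion K)))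
    (h₂ : oneCocycleClass _ φ₂ ∈ DiscreteGaloisModule.transverseSubgroup (GaloisRep.toLocal q (κ.twistModP ρ hM J))
        (CyclotomicField (Ideal.absNorm q.asIdeal) (q.adicCompletion K)))
    (h : φ₁.1 t₀ = φ₂.1 t₀) :
    oneCocycleClass _ φ₁ = oneCocycleClass _ φ₂ := by
  have hI : ∀ t ∈ absInertia (q.adicCompletion K), ∀ x : Fin J → M,
      GaloisRep.toLocal q (κ.twistModP ρ hM J) t x = x :=
    fun _ ht x => toLocal_twistModP_apply_of_mem_absInertia ρ hM κ J q hunr hqp ht x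
  rw [← sub_eq_zero, ← oneCocycleClass_sub]
  refine eq_zero_of_mem_transverseSubgroup_of_apply_eq_zero _ (Ideal.absNorm q.asIdeal)
    (ringChar_residueField_adicCompletion_eq q) hI (sub_one_smul_eq_zero_of_dvd hM hpl) hχI ht₀ hgen
    (φ₁ - φ₂) ?_ ?_
  · rw [oneCocycleClass_sub]; exact AddSubgroup.sub_mem _ h₁ h₂
  · rw [Submodule.coe_sub, ContinuousMap.sub_apply, h, sub_self]

end SplitValues

end Summit.BirchSwinnertonDyer.BirchSwinnertonDyer.Rank1Residual.LocalSplitPrime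

end
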